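import Mathlib.LinearAlgebra.CrossProduct
import Summits.Ventures.Crystal3D.StickySpheres.SlabTransversal
import Summits.Ventures.Crystal3D.StickySpheres.PlaneCoordinates
import Summits.Ventures.Crystal3D.StickySpheres.AffineDiscCount
import HarnessLib

/-!
# Bond lines through a slab sample: the lattice-free per-class count

HONEST FRAMING. Part of the venture `Summits/Ventures/Crystal3D` (cell `crystal3d-full`), helper
for the crux `NoReconstructionGain` (stmt-Ventures-19144) of `route-Ventures-StickyWulffConstant`,
line `adhesion`, registered stub `stub_sampleDeficit` (the sample's own deficiency counts its two
flat faces).  Pure Euclidean geometry and counting in `ℝ³`; nothing about packings.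

**Theorem** (`sqrt_two_mul_abs_inner_mul_pi_mul_sq_le_card`).  `ν` a unit vector, `1 ≤ R ≤ ρ`;
`Ea, Eb` of norm `≤ 1`, `W` a unit vector with `det(Ea, Eb, W)² = 1/2` (a unimodular frame of the
fcc lattice with nearest-neighbour distance `1`: covolume `1/√2`).  If `T ⊆ ℤ²` contains every
`(a, b)` for which some INTEGER `t` puts `a•Ea + b•Eb + t•W` in the slab sample
`{−2R ≤ ⟪p,ν⟫ ≤ −R, ‖p‖² − ⟪p,ν⟫² ≤ ρ²}`, then `√2 |⟪W,ν⟫| π ρ² − 10 √2 π ρ ≤ #T`.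
So the bond lines of direction `W` that meet the sample number at least `√2|⟪W,ν⟫|πρ² − O(ρ)`,
with the `O(ρ)` UNIFORM in `ν` and in the line class.

Proof: the mid-plane crossings of the lines `(a, b) + ℤW` form the affine lattice
`c₀ + aX + bY` in `ν^⊥` (`X, Y` the oblique projections of `Ea, Eb` along `W`); a crossing at
lateral distance `≤ ρ − 1` gives an integer point in the sample (`exists_int_mem_slabSample`);
in orthonormal coordinates of `ν^⊥` (`exists_planeCoordinates`) the crossings are `A ℤ² + β`
with `|det A|² = Gram(X, Y)`, and the SHEAR IDENTITY `⟪W,ν⟫² · Gram(X, Y) = det(Ea, Eb, W)²`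
(`sq_mul_gram_shear`, via cross products) gives `√2 |⟪W,ν⟫| |det A| = 1`; the affine disc count
(`affine_disc_count`) with cell diameter `r = ‖X‖ + ‖Y‖`, `|⟪W,ν⟫| (1 + r) ≤ 5`, finishes.

WHAT THIS IS NOT: no lattice enumeration, no deficiency; the crux itself (off-lattice
continuations) is untouched; rung F-C1 not moved.
-/

noncomputable section

namespace Summit.Ventures.Crystal3D.Theorems

open Summit.Ventures.Crystal3D Matrix
open scoped InnerProductSpace

/-- **Shear identity for the crossing lattice.**  For `Ea Eb W n : ℝ³` with `α = W ⬝ n ≠ 0`, the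
oblique projections `X = Ea − (Ea⬝n/α) W`, `Y = Eb − (Eb⬝n/α) W` along `W` onto `n^⊥` satisfy
`α² · Gram(X, Y) = det(Ea, Eb, W)² · ‖n‖²`. -/
theorem sq_mul_gram_shear (Ea Eb W n : Fin 3 → ℝ) (hα : W ⬝ᵥ n ≠ 0) :
    (W ⬝ᵥ n) ^ 2 *
        (((Ea - ((Ea ⬝ᵥ n) / (W ⬝ᵥ n)) • W) ⬝ᵥ (Ea - ((Ea ⬝ᵥ n) / (W ⬝ᵥ n)) • W)) *
          ((Eb - ((Eb ⬝ᵥ n) / (W ⬝ᵥ n)) • W) ⬝ᵥ (Eb - ((Eb ⬝ᵥ n) / (W ⬝ᵥ n)) • W)) -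
         ((Ea - ((Ea ⬝ᵥ n) / (W ⬝ᵥ n)) • W) ⬝ᵥ (Eb - ((Eb ⬝ᵥ n) / (W ⬝ᵥ n)) • W)) ^ 2) =
      (Matrix.det ![Ea, Eb, W]) ^ 2 * (n ⬝ᵥ n) := by
  set α : ℝ := W ⬝ᵥ n with hαdef
  set X : Fin 3 → ℝ := Ea - ((Ea ⬝ᵥ n) / α) • W with hX
  set Y : Fin 3 → ℝ := Eb - ((Eb ⬝ᵥ n) / α) • W with hY
  have hXn : X ⬝ᵥ n = 0 := by
    rw [hX, sub_dotProduct, smul_dotProduct, smul_eq_mul, ← hαdef]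
    field_simp; ring
  have hYn : Y ⬝ᵥ n = 0 := by
    rw [hY, sub_dotProduct, smul_dotProduct, smul_eq_mul, ← hαdef]
    field_simp; ring
  set p : Fin 3 → ℝ := crossProduct X Y with hp
  -- Lagrange: ‖p‖² = Gram(X, Y)
  have hpp : p ⬝ᵥ p = (X ⬝ᵥ X) * (Y ⬝ᵥ Y) - (X ⬝ᵥ Y) ^ 2 := by
    rw [hp, cross_dot_cross, dotProduct_comm Y X]; ring
  -- p × n = 0 since X, Y ⊥ n
  have hpn : crossProduct p n = 0 := by
    rw [hp, cross_cross_eq_smul_sub_smul, hXn, hYn, zero_smul, zero_smul, sub_zero]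
  -- W × (p × n) = α p − (p⬝W) n = 0
  have hkey : α • p = (p ⬝ᵥ W) • n := by
    have h := cross_cross_eq_smul_sub_smul' W p n
    rw [hpn, map_zero, ← hαdef] at h
    exact (sub_eq_zero.1 h.symm)
  -- p ⬝ W = det(Ea, Eb, W)
  have hpW : p ⬝ᵥ W = Matrix.det ![Ea, Eb, W] := by
    rw [dotProduct_comm, hp, triple_product_eq_det, Matrix.det_fin_three, Matrix.det_fin_three]
    simp [hX, hY]
    ring
  -- square both sides of the key identity
  have h1 : (α • p) ⬝ᵥ (α • p) = α ^ 2 * (p ⬝ᵥ p) := by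
    rw [smul_dotProduct, dotProduct_smul, smul_eq_mul, smul_eq_mul]; ring
  have h2 : ((p ⬝ᵥ W) • n) ⬝ᵥ ((p ⬝ᵥ W) • n) = (p ⬝ᵥ W) ^ 2 * (n ⬝ᵥ n) := by
    rw [smul_dotProduct, dotProduct_smul, smul_eq_mul, smul_eq_mul]; ring
  rw [← hpp, ← hpW, ← h1, hkey, h2]

/-- Real inner product on `ℝ³` as a dot product of coordinate vectors. -/
theorem real_inner_eq_dotProduct_ofLp_fin3 (p q : EuclideanSpace ℝ (Fin 3)) :
    ⟪p, q⟫_ℝ = (WithLp.ofLp p) ⬝ᵥ (WithLp.ofLp q) := by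
  rw [EuclideanSpace.inner_eq_star_dotProduct, star_trivial, dotProduct_comm]

/-- **Gram of the oblique projections in `ℝ³`** (Euclidean-space form of `sq_mul_gram_shear`):
with `α = ⟪W, ν⟫ ≠ 0`, `X = Ea − (⟪Ea,ν⟫/α) W`, `Y = Eb − (⟪Eb,ν⟫/α) W`:
`α² (‖X‖²‖Y‖² − ⟪X,Y⟫²) = det(Ea, Eb, W)² ‖ν‖²`. -/
theorem sq_mul_gram_shear_euclidean (Ea Eb W ν : EuclideanSpace ℝ (Fin 3)) (hα : ⟪W, ν⟫_ℝ ≠ 0) :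
    ⟪W, ν⟫_ℝ ^ 2 *
        (‖Ea - (⟪Ea, ν⟫_ℝ / ⟪W, ν⟫_ℝ) • W‖ ^ 2 * ‖Eb - (⟪Eb, ν⟫_ℝ / ⟪W, ν⟫_ℝ) • W‖ ^ 2 -
          ⟪Ea - (⟪Ea, ν⟫_ℝ / ⟪W, ν⟫_ℝ) • W, Eb - (⟪Eb, ν⟫_ℝ / ⟪W, ν⟫_ℝ) • W⟫_ℝ ^ 2) =
      (Matrix.det ![WithLp.ofLp Ea, WithLp.ofLp Eb, WithLp.ofLp W]) ^ 2 * ‖ν‖ ^ 2 := by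
  have hαd : (WithLp.ofLp W) ⬝ᵥ (WithLp.ofLp ν) ≠ 0 := by
    rwa [← real_inner_eq_dotProduct_ofLp_fin3]
  have h := sq_mul_gram_shear (WithLp.ofLp Ea) (WithLp.ofLp Eb) (WithLp.ofLp W) (WithLp.ofLp ν) hαd
  simp only [← real_inner_eq_dotProduct_ofLp_fin3] at h
  rw [← real_inner_self_eq_norm_sq, ← real_inner_self_eq_norm_sq, ← real_inner_self_eq_norm_sq,
    real_inner_eq_dotProduct_ofLp_fin3, real_inner_eq_dotProduct_ofLp_fin3,
    real_inner_eq_dotProduct_ofLp_fin3 (Ea - _),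
    real_inner_eq_dotProduct_ofLp_fin3 ν]
  simp only [WithLp.ofLp_sub, WithLp.ofLp_smul]
  simp only [real_inner_eq_dotProduct_ofLp_fin3] at h ⊢
  exact h

/-- **Per-class line count (lattice-free).** `ν` unit, `1 ≤ R ≤ ρ`; `Ea, Eb` of norm `≤ 1`, `W`
unit, `det(Ea, Eb, W)² = 1/2`.  If `T ⊆ ℤ²` contains every `(a, b)` for which some integer `t` puts
`a•Ea + b•Eb + t•W` in the slab sample `{−2R ≤ ⟪p,ν⟫ ≤ −R, ‖p‖² − ⟪p,ν⟫² ≤ ρ²}`, then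
`√2 |⟪W,ν⟫| π ρ² − 10 √2 π ρ ≤ #T`. -/
theorem sqrt_two_mul_abs_inner_mul_pi_mul_sq_le_card (ν : EuclideanSpace ℝ (Fin 3)) (hν : ‖ν‖ = 1)
    (R ρ : ℝ) (hR : 1 ≤ R) (hρ : R ≤ ρ) (Ea Eb W : EuclideanSpace ℝ (Fin 3))
    (hEa : ‖Ea‖ ≤ 1) (hEb : ‖Eb‖ ≤ 1) (hW : ‖W‖ = 1)
    (hdet : (Matrix.det ![WithLp.ofLp Ea, WithLp.ofLp Eb, WithLp.ofLp W]) ^ 2 = 1 / 2)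
    (T : Finset (ℤ × ℤ))
    (hT : ∀ a b t : ℤ,
      -(2 * R) ≤ ⟪(a : ℝ) • Ea + (b : ℝ) • Eb + (t : ℝ) • W, ν⟫_ℝ →
      ⟪(a : ℝ) • Ea + (b : ℝ) • Eb + (t : ℝ) • W, ν⟫_ℝ ≤ -R →
      ‖(a : ℝ) • Ea + (b : ℝ) • Eb + (t : ℝ) • W‖ ^ 2 -
          ⟪(a : ℝ) • Ea + (b : ℝ) • Eb + (t : ℝ) • W, ν⟫_ℝ ^ 2 ≤ ρ ^ 2 →
      (a, b) ∈ T) :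
    Real.sqrt 2 * |⟪W, ν⟫_ℝ| * Real.pi * ρ ^ 2 - 10 * Real.sqrt 2 * Real.pi * ρ ≤ (T.card : ℝ) := by
  have hρ1 : 1 ≤ ρ := hR.trans hρ
  have hρ0 : 0 ≤ ρ := by linarith
  have h2pos : 0 < Real.sqrt 2 := Real.sqrt_pos.2 (by norm_num)
  have h2sq : Real.sqrt 2 ^ 2 = 2 := Real.sq_sqrt (by norm_num)
  have hTnn : (0 : ℝ) ≤ (T.card : ℝ) := Nat.cast_nonneg _
  set α : ℝ := ⟪W, ν⟫_ℝ with hαdef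
  -- |α| ≤ 1, |⟪Ea,ν⟫| ≤ 1, |⟪Eb,ν⟫| ≤ 1
  have hαle : |α| ≤ 1 := by
    have h := abs_real_inner_le_norm W ν; rw [hW, hν, one_mul] at h; exact h
  have hEaν : |⟪Ea, ν⟫_ℝ| ≤ 1 := by
    have h := abs_real_inner_le_norm Ea ν; rw [hν, mul_one] at h; exact h.trans hEa
  have hEbν : |⟪Eb, ν⟫_ℝ| ≤ 1 := by
    have h := abs_real_inner_le_norm Eb ν; rw [hν, mul_one] at h; exact h.trans hEb
  by_cases hα0 : α = 0
  · rw [hα0, abs_zero, mul_zero, zero_mul, zero_mul, zero_sub]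
    have : 0 ≤ 10 * Real.sqrt 2 * Real.pi * ρ := by positivity
    linarith
  have hαpos : 0 < |α| := abs_pos.2 hα0
  -- the oblique projections and the centre
  set X : EuclideanSpace ℝ (Fin 3) := Ea - (⟪Ea, ν⟫_ℝ / α) • W with hX
  set Y : EuclideanSpace ℝ (Fin 3) := Eb - (⟪Eb, ν⟫_ℝ / α) • W with hY
  set c₀ : EuclideanSpace ℝ (Fin 3) := (3 * R / 2) • ν - (3 * R / (2 * α)) • W with hc₀
  have hνν : ⟪ν, ν⟫_ℝ = 1 := by rw [real_inner_self_eq_norm_sq, hν, one_pow]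
  have hXν : ⟪X, ν⟫_ℝ = 0 := by
    rw [hX, inner_sub_left, inner_smul_left]; simp only [conj_trivial]; rw [← hαdef]; field_simp; ring
  have hYν : ⟪Y, ν⟫_ℝ = 0 := by
    rw [hY, inner_sub_left, inner_smul_left]; simp only [conj_trivial]; rw [← hαdef]; field_simp; ring
  have hc₀ν : ⟪c₀, ν⟫_ℝ = 0 := by
    rw [hc₀, inner_sub_left, inner_smul_left, inner_smul_left]; simp only [conj_trivial]
    rw [hνν, ← hαdef]; field_simp; ring
  -- norms of X, Y: |α| ‖X‖ ≤ 2
  have hXn : |α| * ‖X‖ ≤ 2 := by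
    have h1 : |α| * ‖X‖ = ‖α • Ea - ⟪Ea, ν⟫_ℝ • W‖ := by
      rw [← Real.norm_eq_abs, ← norm_smul, hX, smul_sub, smul_smul, mul_div_cancel₀ _ hα0]
    rw [h1]
    have h2 : ‖α • Ea - ⟪Ea, ν⟫_ℝ • W‖ ≤ |α| * ‖Ea‖ + |⟪Ea, ν⟫_ℝ| * ‖W‖ := by
      calc ‖α • Ea - ⟪Ea, ν⟫_ℝ • W‖ ≤ ‖α • Ea‖ + ‖⟪Ea, ν⟫_ℝ • W‖ := norm_sub_le _ _
        _ = |α| * ‖Ea‖ + |⟪Ea, ν⟫_ℝ| * ‖W‖ := by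
            rw [norm_smul, norm_smul, Real.norm_eq_abs, Real.norm_eq_abs]
    rw [hW, mul_one] at h2
    nlinarith [abs_nonneg α, norm_nonneg Ea, abs_nonneg ⟪Ea, ν⟫_ℝ]
  have hYn : |α| * ‖Y‖ ≤ 2 := by
    have h1 : |α| * ‖Y‖ = ‖α • Eb - ⟪Eb, ν⟫_ℝ • W‖ := by
      rw [← Real.norm_eq_abs, ← norm_smul, hY, smul_sub, smul_smul, mul_div_cancel₀ _ hα0]
    rw [h1]
    have h2 : ‖α • Eb - ⟪Eb, ν⟫_ℝ • W‖ ≤ |α| * ‖Eb‖ + |⟪Eb, ν⟫_ℝ| * ‖W‖ := by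
      calc ‖α • Eb - ⟪Eb, ν⟫_ℝ • W‖ ≤ ‖α • Eb‖ + ‖⟪Eb, ν⟫_ℝ • W‖ := norm_sub_le _ _
        _ = |α| * ‖Eb‖ + |⟪Eb, ν⟫_ℝ| * ‖W‖ := by
            rw [norm_smul, norm_smul, Real.norm_eq_abs, Real.norm_eq_abs]
    rw [hW, mul_one] at h2
    nlinarith [abs_nonneg α, norm_nonneg Eb, abs_nonneg ⟪Eb, ν⟫_ℝ]
  set r : ℝ := ‖X‖ + ‖Y‖ with hr
  have hr0 : 0 ≤ r := by positivity
  have hαr : |α| * (1 + r) ≤ 5 := by rw [hr]; nlinarith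
  -- the small-ρ case is trivial
  by_cases hrρ : ρ - 1 < r
  · have h1 : |α| * ρ ≤ 5 := by nlinarith
    have h3 : 0 ≤ Real.sqrt 2 * Real.pi * ρ := by positivity
    have h4 : Real.sqrt 2 * |α| * Real.pi * ρ ^ 2 = (Real.sqrt 2 * Real.pi * ρ) * (|α| * ρ) := by
      ring
    have h5 : Real.sqrt 2 * |α| * Real.pi * ρ ^ 2 ≤ (Real.sqrt 2 * Real.pi * ρ) * 5 := by
      rw [h4]; exact mul_le_mul_of_nonneg_left h1 h3
    nlinarith
  push Not at hrρ
  -- plane coordinates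
  obtain ⟨A, β, hAβ, hdetA, hAf⟩ := exists_planeCoordinates ν X Y c₀ hν hXν hYν hc₀ν
  -- Gram identity ⇒ 2 α² det(A)² = 1
  have hgram := sq_mul_gram_shear_euclidean Ea Eb W ν hα0
  rw [← hαdef, ← hX, ← hY, hdet, hν, one_pow, mul_one, ← hdetA] at hgram
  -- hgram : α ^ 2 * A.det ^ 2 = 1 / 2
  have hdetabs : Real.sqrt 2 * |α| * |A.det| = 1 := by
    have hnn : 0 ≤ Real.sqrt 2 * |α| * |A.det| := by positivity
    have hsq : (Real.sqrt 2 * |α| * |A.det|) ^ 2 = 1 := by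
      rw [mul_pow, mul_pow, h2sq, sq_abs, sq_abs]; linarith
    exact (pow_eq_one_iff_of_nonneg hnn (by norm_num)).1 hsq
  have hAdet : A.det ≠ 0 := by
    intro h; rw [h, abs_zero, mul_zero] at hdetabs; exact zero_ne_one hdetabs
  -- the affine disc count
  have hbound : ∀ f : Fin 2 → ℝ, (∀ m, 0 ≤ f m ∧ f m < 1) →
      (A.mulVec f 0) ^ 2 + (A.mulVec f 1) ^ 2 ≤ r ^ 2 := by
    intro f hf
    rw [hAf]
    have h0 := hf 0; have h1 := hf 1
    have hle : ‖f 0 • X + f 1 • Y‖ ≤ r := by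
      calc ‖f 0 • X + f 1 • Y‖ ≤ ‖f 0 • X‖ + ‖f 1 • Y‖ := norm_add_le _ _
        _ = |f 0| * ‖X‖ + |f 1| * ‖Y‖ := by rw [norm_smul, norm_smul, Real.norm_eq_abs, Real.norm_eq_abs]
        _ ≤ 1 * ‖X‖ + 1 * ‖Y‖ := by
            gcongr
            · rw [abs_of_nonneg h0.1]; exact h0.2.le
            · rw [abs_of_nonneg h1.1]; exact h1.2.le
        _ = r := by rw [hr]; ring
    exact pow_le_pow_left₀ (norm_nonneg _) hle 2
  have hdisc := affine_disc_count A hAdet β 0 r (ρ - 1) hr0 hrρ hbound T ?_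
  swap
  · intro i j hij
    simp only [Pi.zero_apply, sub_zero] at hij
    -- the mid-plane crossing of the line (i, j) has lateral norm ≤ ρ - 1
    have hlat : ‖c₀ + (i : ℝ) • X + (j : ℝ) • Y‖ ^ 2 ≤ (ρ - 1) ^ 2 := by rw [hAβ]; exact hij
    set P₀ : EuclideanSpace ℝ (Fin 3) := (i : ℝ) • Ea + (j : ℝ) • Eb with hP₀
    have hQ : ‖P₀ + (-(⟪P₀, ν⟫_ℝ + 3 * R / 2) / ⟪W, ν⟫_ℝ) • W‖ ^ 2 -
        ⟪P₀ + (-(⟪P₀, ν⟫_ℝ + 3 * R / 2) / ⟪W, ν⟫_ℝ) • W, ν⟫_ℝ ^ 2 ≤ (ρ - 1) ^ 2 := by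
      rw [← norm_sub_inner_smul_sq ν _ hν]
      have hP₀ν : ⟪P₀, ν⟫_ℝ = (i : ℝ) * ⟪Ea, ν⟫_ℝ + (j : ℝ) * ⟪Eb, ν⟫_ℝ := by
        rw [hP₀, inner_add_left, inner_smul_left, inner_smul_left]; simp
      have heq : P₀ + (-(⟪P₀, ν⟫_ℝ + 3 * R / 2) / ⟪W, ν⟫_ℝ) • W -
          ⟪P₀ + (-(⟪P₀, ν⟫_ℝ + 3 * R / 2) / ⟪W, ν⟫_ℝ) • W, ν⟫_ℝ • ν =
          c₀ + (i : ℝ) • X + (j : ℝ) • Y := by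
        have hin : ⟪P₀ + (-(⟪P₀, ν⟫_ℝ + 3 * R / 2) / ⟪W, ν⟫_ℝ) • W, ν⟫_ℝ = -(3 * R / 2) := by
          rw [inner_add_left, inner_smul_left]; simp only [conj_trivial]; rw [← hαdef]
          field_simp; ring
        rw [hin, hP₀ν, ← hαdef, hc₀, hX, hY, hP₀]
        have e1 : (-((i : ℝ) * ⟪Ea, ν⟫_ℝ + (j : ℝ) * ⟪Eb, ν⟫_ℝ + 3 * R / 2) / α) =
            -((i : ℝ) * (⟪Ea, ν⟫_ℝ / α)) - (j : ℝ) * (⟪Eb, ν⟫_ℝ / α) - 3 * R / (2 * α) := by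
          field_simp; ring
        rw [e1]
        module
      rw [heq]; exact hlat
    obtain ⟨t, ht1, ht2, ht3⟩ :=
      exists_int_mem_slabSample ν P₀ W hν hW.le hα0 R ρ hR hρ1 hQ
    exact hT i j t (by rw [hP₀] at ht1; exact ht1) (by rw [hP₀] at ht2; exact ht2)
      (by rw [hP₀] at ht3; exact ht3)
  -- assemble: √2|α| π (ρ-1-r)² ≤ #T
  have hmain : Real.sqrt 2 * |α| * (Real.pi * (ρ - 1 - r) ^ 2) ≤ (T.card : ℝ) := by
    have h := mul_le_mul_of_nonneg_left hdisc (by positivity : (0 : ℝ) ≤ Real.sqrt 2 * |α|)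
    calc Real.sqrt 2 * |α| * (Real.pi * (ρ - 1 - r) ^ 2)
        ≤ Real.sqrt 2 * |α| * (|A.det| * (T.card : ℝ)) := h
      _ = (Real.sqrt 2 * |α| * |A.det|) * (T.card : ℝ) := by ring
      _ = (T.card : ℝ) := by rw [hdetabs, one_mul]
  -- (ρ-1-r)² ≥ ρ² - 2(1+r)ρ and |α|(1+r) ≤ 5
  have hexp : Real.sqrt 2 * |α| * Real.pi * ρ ^ 2 - 10 * Real.sqrt 2 * Real.pi * ρ ≤
      Real.sqrt 2 * |α| * (Real.pi * (ρ - 1 - r) ^ 2) := by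
    have e : Real.sqrt 2 * |α| * (Real.pi * (ρ - 1 - r) ^ 2) =
        Real.sqrt 2 * |α| * Real.pi * ρ ^ 2 - (2 * Real.sqrt 2 * Real.pi * ρ) * (|α| * (1 + r)) +
          Real.sqrt 2 * |α| * Real.pi * (1 + r) ^ 2 := by ring
    have h3 : (2 * Real.sqrt 2 * Real.pi * ρ) * (|α| * (1 + r)) ≤ (2 * Real.sqrt 2 * Real.pi * ρ) * 5 :=
      mul_le_mul_of_nonneg_left hαr (by positivity)
    have h4 : 0 ≤ Real.sqrt 2 * |α| * Real.pi * (1 + r) ^ 2 := by positivity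
    rw [e]
    linarith
  linarith

end Summit.Ventures.Crystal3D.Theorems

end
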